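import Literature.Analysis.FluidPDE.KNSSRegularityGalileanProofs
import Literature.Analysis.FluidPDE.OseenHeatLinear
import Literature.Analysis.FluidPDE.KNSSMildBootstrapTools
import Literature.Analysis.UnboundedOperators.HeatKernelBoundedData
import HarnessLib

/-!
# The difference-quotient bootstrap for bounded mild solutions, I: level data, the base level,
# and the Oseen operator on differences of the level tensors

Analysis/FluidPDE support file (everything proved; no definitions, no named facts) on the
discharge path of `Literature.Analysis.FluidPDE.KNSS2009_mild_regularity`
(`KNSSRegularityGalilean`; Koch–Nadirashvili–Seregin–Šverák, Acta Math. 203 (2009) =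
arXiv:0709.3599v1, §4: Proposition 4.1 with (4.6), and the closing paragraph (4.8)–(4.11), for
bounded mild solutions of Navier–Stokes in `ℝ³`), through which the tree has reduced the whole
regularity input "by the results of Section 4" of KNSS's Theorems 5.2–5.3
(`KNSS2009_regularity_boundedWeak_ancient_of_mild'`, `KNSSRegularityGalileanProofs`).

A bounded mild solution is rendered in the tree as a field `V` with `IsKNSSDriftMild T N V 0`
(`KNSSRegularityDecomposition`): jointly measurable, `‖V‖ ≤ N` on `(0, T) × E`, weakly
divergence-free at a.e. time, and
`V(τ) = e^{(τ−s)Δ}V(s) − ∫ₛ^τ ∑ᵢ 𝒩_{τ−σ}[V(σ) ⊗ V(σ)]ᵢ eᵢ dσ` pointwise for `0 < s < τ < T`, with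
`𝒩_τ = oseenHeat τ` the heat-flow realisation of `e^{τΔ}P∇·` and `V ⊗ V` the frame tensor
`driftTensor V 0`. The **level-`k` data** of the bootstrap (KNSS (4.5)–(4.6): "an estimate of
`B` … in spaces with norms given by `‖t^{k/2}∇ᵏₓu‖_∞`") are, for a field `V` on the window:
(i) `V(τ) ∈ Cᵏ`; (ii) sup bounds `‖DʲV(τ)‖ ≤ A` (`j ≤ k`) on `[δ, T)`; (iii) the **`k`-times
differentiated mild identity**, in evaluated form: for every `k`-tuple `m`,
`DᵏV(τ)(x)·m = e^{(τ−s)Δ}[DᵏV(s)·m](x) − ∫ₛ^τ ∑ᵢ 𝒩_{τ−σ}[Tₖᵐ(σ)]ᵢ(x) eᵢ dσ` with the level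
tensor `Tₖᵐ(σ)ⱼₗ(y) = Dᵏ(VⱼVₗ)(σ, y)·m`; (iv) measurability of `σ ↦ 𝒩_{τ−σ}[Tₖᵐ(σ)]ᵢ(x)` at
every point. This file provides:

* `§ SliceTensor`: for one slice `W : E → E` in `Cᵏ` with `‖DʲW‖ ≤ A`, the frame products
  `y ↦ ⟪W y, eⱼ⟫⟪W y, eₗ⟫` are `Cᵏ` with `‖Dⁱ(WⱼWₗ)‖ ≤ 2ᵏA²`
  (`norm_iteratedFDeriv_frameProduct_le`); the evaluated level tensor is continuous, bounded by
  `2ᵏA² ∏‖mᵢ‖`, in `L^∞`; and the **first-difference bound**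
  `‖Dᵏ(WⱼWₗ)(y + h) − Dᵏ(WⱼWₗ)(y)‖ ≤ 2Aq + 2ᵏ⁺¹A²‖h‖` whenever `‖DᵏW(· + h) − DᵏW‖ ≤ q`
  (`norm_iteratedFDeriv_frameProduct_add_sub_le`: discrete Leibniz rule, the mean value theorem
  on the orders `< k`, the unknown `q` at the top order — KNSS's "taking difference quotients",
  (3.12));
* `§ OseenDifference` (`dim E = 3`): `𝒩_τ[Tₖᵐ](x + h) − 𝒩_τ[Tₖᵐ](x) = 𝒩_τ[Tₖᵐ(· + h) − Tₖᵐ](x)`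
  (translation covariance and linearity of `oseenHeat`) and
  `‖∑ᵢ(…)ᵢeᵢ‖ ≤ 8829 τ^{-1/2} (2Aq + 2ᵏ⁺¹A²‖h‖) ∏‖mᵢ‖` (`norm_sum_oseenHeat_levelTensor_sub_smul_le`);
  the size `‖∑ᵢ 𝒩_τ[Tₖᵐ]ᵢ(x)eᵢ‖ ≤ 8829 τ^{-1/2} 2ᵏA² ∏‖mᵢ‖` and the interval integrability of the
  level-`k` Duhamel integrand from (iv);
* `§ LevelZero`: the level-`0` data for `IsKNSSDriftMild T N V 0` — continuity of slices, the
  bound `N`, the identity (iii)₀ = the drift-mild identity, and (iv)₀ from the tree's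
  `aestronglyMeasurable_oseenHeat_sub_section`.

The singular-Gronwall Lipschitz step, the upgrade `Cᵏ → Cᵏ⁺¹` and the differentiation of the
identity are in the sequel files. Everything is in the sub-namespace `KNSSBootstrap`.

## Mathlib / tree search

Tree: `driftTensor_zero_apply`, `oseenHeat_comp_add_right`, `heatExtension_comp_add_right_apply`,
`IsKNSSDriftMild.continuous_slice/aestronglyMeasurable_slice/measurable_driftTensor/abs_driftTensor_le`
(`KNSSRegularityGalileanProofs`, `OseenDuhamelMeasurable`), `oseenHeat_sub_of_memLp`
(`OseenHeatLinear`), `norm_oseenHeat_le_of_top` (`OseenHeatSemigroup`),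
`aestronglyMeasurable_oseenHeat_sub_section`, `norm_sum_smul_stdOrthonormalBasis_le`
(`OseenDuhamelMeasurable`); the calculus helpers of `KNSSMildBootstrapTools`. Mathlib:
`iteratedFDeriv_comp_add_right`, `iteratedFDeriv_add_apply`, `ContinuousMultilinearMap.le_opNorm`.

## References

* G. Koch, N. Nadirashvili, G. Seregin, V. Šverák, *Liouville theorems for the Navier–Stokes
  equations and applications*, Acta Math. 203 (2009) 83–105 = arXiv:0709.3599v1, §3
  (3.12)–(3.13) ("taking difference quotients"), §4 (4.3)–(4.6), Prop. 4.1.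
  [KochNadirashviliSereginSverak2009]
* Y. Giga, K. Inui, S. Matsui, Quad. Mat. 4 (1999) 27–68, §3.
-/

noncomputable section

open MeasureTheory Set Function Filter TopologicalSpace InnerProductSpace Metric
open _root_.Topology
open scoped RealInnerProductSpace NNReal ENNReal

namespace Literature.Analysis.FluidPDE

namespace KNSSBootstrap

/-! ### Frame products of one slice and their level tensors -/

section SliceTensor

variable {E : Type*} [NormedAddCommGroup E] [InnerProductSpace ℝ E] [FiniteDimensional ℝ E]

variable {W : E → E} {n : WithTop ℕ∞} {k : ℕ} {A : ℝ}

/-- The frame product `y ↦ ⟪W y, eⱼ⟫⟪W y, eₗ⟫` of a `Cⁿ` field is `Cⁿ`. [folklore] -/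
theorem contDiff_frameProduct (hW : ContDiff ℝ n W) (j l : Fin (Module.finrank ℝ E)) :
    ContDiff ℝ n fun y => ⟪W y, stdOrthonormalBasis ℝ E j⟫ * ⟪W y, stdOrthonormalBasis ℝ E l⟫ :=
  (hW.inner ℝ contDiff_const).mul (hW.inner ℝ contDiff_const)

/-- Sup bounds of the frame components: `‖Dⁱ⟪W, eⱼ⟫‖ ≤ A` for `i ≤ k` when `‖DⁱW‖ ≤ A` for
`i ≤ k`. [folklore] -/
theorem norm_iteratedFDeriv_frameComponent_le (hW : ContDiff ℝ n W) (hk : (k : WithTop ℕ∞) ≤ n)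
    (hbd : ∀ i ≤ k, ∀ y, ‖iteratedFDeriv ℝ i W y‖ ≤ A) (j : Fin (Module.finrank ℝ E))
    {i : ℕ} (hi : i ≤ k) (y : E) :
    ‖iteratedFDeriv ℝ i (fun y => ⟪W y, stdOrthonormalBasis ℝ E j⟫) y‖ ≤ A :=
  (norm_iteratedFDeriv_inner_const_le hW (norm_stdOrthonormalBasis_le_one (E := E) j)
    ((show ((i : ℕ) : WithTop ℕ∞) ≤ k by exact_mod_cast hi).trans hk) y).trans (hbd i hi y)

/-- **Sup bounds of the frame products**: `‖Dⁱ(WⱼWₗ)‖ ≤ 2ᵏA²` for `i ≤ k`. [folklore] -/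
theorem norm_iteratedFDeriv_frameProduct_le (hW : ContDiff ℝ n W) (hk : (k : WithTop ℕ∞) ≤ n)
    (hA : 0 ≤ A) (hbd : ∀ i ≤ k, ∀ y, ‖iteratedFDeriv ℝ i W y‖ ≤ A)
    (j l : Fin (Module.finrank ℝ E)) {i : ℕ} (hi : i ≤ k) (y : E) :
    ‖iteratedFDeriv ℝ i
        (fun y => ⟪W y, stdOrthonormalBasis ℝ E j⟫ * ⟪W y, stdOrthonormalBasis ℝ E l⟫) y‖ ≤
      2 ^ k * A ^ 2 := by
  have hi' : ((i : ℕ) : WithTop ℕ∞) ≤ n := (show ((i : ℕ) : WithTop ℕ∞) ≤ k by exact_mod_cast hi).trans hk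
  have h := norm_iteratedFDeriv_mul_le_of_bounds (hW.inner ℝ contDiff_const) (hW.inner ℝ contDiff_const)
    hi' hA (fun i' hi'' z => norm_iteratedFDeriv_frameComponent_le hW hk hbd j (hi''.trans hi) z)
    (fun i' hi'' z => norm_iteratedFDeriv_frameComponent_le hW hk hbd l (hi''.trans hi) z) y
  refine h.trans ?_
  have h2 : (2 : ℝ) ^ i ≤ 2 ^ k := pow_le_pow_right₀ (by norm_num) hi
  nlinarith [sq_nonneg A]

/-- The evaluated level tensor `y ↦ Dᵏ(WⱼWₗ)(y)·m` of a `Cᵏ` slice is continuous. [folklore] -/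
theorem continuous_levelTensor (hW : ContDiff ℝ k W) (j l : Fin (Module.finrank ℝ E))
    (m : Fin k → E) :
    Continuous fun y => iteratedFDeriv ℝ k
      (fun y => ⟪W y, stdOrthonormalBasis ℝ E j⟫ * ⟪W y, stdOrthonormalBasis ℝ E l⟫) y m :=
  (ContinuousMultilinearMap.apply ℝ (fun _ : Fin k => E) ℝ m).continuous.comp
    ((contDiff_frameProduct hW j l).continuous_iteratedFDeriv le_rfl)

/-- **Size of the evaluated level tensor**: `|Dᵏ(WⱼWₗ)(y)·m| ≤ 2ᵏA² ∏‖mᵢ‖`. [folklore] -/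
theorem abs_levelTensor_le (hW : ContDiff ℝ k W) (hA : 0 ≤ A)
    (hbd : ∀ i ≤ k, ∀ y, ‖iteratedFDeriv ℝ i W y‖ ≤ A) (j l : Fin (Module.finrank ℝ E))
    (m : Fin k → E) (y : E) :
    |iteratedFDeriv ℝ k
        (fun y => ⟪W y, stdOrthonormalBasis ℝ E j⟫ * ⟪W y, stdOrthonormalBasis ℝ E l⟫) y m| ≤
      2 ^ k * A ^ 2 * ∏ i, ‖m i‖ := by
  rw [← Real.norm_eq_abs]
  refine (ContinuousMultilinearMap.le_opNorm _ _).trans ?_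
  exact mul_le_mul_of_nonneg_right (norm_iteratedFDeriv_frameProduct_le hW le_rfl hA hbd j l le_rfl y)
    (Finset.prod_nonneg fun i _ => norm_nonneg _)

variable [MeasurableSpace E] [BorelSpace E]

/-- The evaluated level tensor of a `Cᵏ` slice with `‖DʲW‖ ≤ A` is in `L^∞` with
`‖·‖_∞ ≤ 2ᵏA² ∏‖mᵢ‖`. [folklore] -/
theorem memLp_top_levelTensor (hW : ContDiff ℝ k W) (hA : 0 ≤ A)
    (hbd : ∀ i ≤ k, ∀ y, ‖iteratedFDeriv ℝ i W y‖ ≤ A) (j l : Fin (Module.finrank ℝ E))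
    (m : Fin k → E) :
    MemLp (fun y => iteratedFDeriv ℝ k
      (fun y => ⟪W y, stdOrthonormalBasis ℝ E j⟫ * ⟪W y, stdOrthonormalBasis ℝ E l⟫) y m) ∞ volume ∧
    eLpNorm (fun y => iteratedFDeriv ℝ k
      (fun y => ⟪W y, stdOrthonormalBasis ℝ E j⟫ * ⟪W y, stdOrthonormalBasis ℝ E l⟫) y m) ∞ volume ≤
      ENNReal.ofReal (2 ^ k * A ^ 2 * ∏ i, ‖m i‖) := by
  have hb : ∀ᵐ y ∂(volume : Measure E), ‖iteratedFDeriv ℝ k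
      (fun y => ⟪W y, stdOrthonormalBasis ℝ E j⟫ * ⟪W y, stdOrthonormalBasis ℝ E l⟫) y m‖ ≤
      2 ^ k * A ^ 2 * ∏ i, ‖m i‖ :=
    Eventually.of_forall fun y => by
      rw [Real.norm_eq_abs]; exact abs_levelTensor_le hW hA hbd j l m y
  exact ⟨memLp_top_of_bound (continuous_levelTensor hW j l m).aestronglyMeasurable _ hb,
    by rw [eLpNorm_exponent_top]; exact eLpNormEssSup_le_of_ae_bound hb⟩

omit [MeasurableSpace E] [BorelSpace E] in
/-- Iterated derivatives of a first difference of a frame component, orders below the top: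
`‖Dⁱ(⟪W(· + h), eⱼ⟫ − ⟪W, eⱼ⟫)(z)‖ ≤ A‖h‖` for `i < k` (mean value theorem with `‖Dⁱ⁺¹W‖ ≤ A`).
[folklore] -/
theorem norm_iteratedFDeriv_frameComponent_sub_le_of_lt (hW : ContDiff ℝ k W)
    (hbd : ∀ i ≤ k, ∀ y, ‖iteratedFDeriv ℝ i W y‖ ≤ A) (j : Fin (Module.finrank ℝ E)) (h : E)
    {i : ℕ} (hi : i < k) (z : E) :
    ‖iteratedFDeriv ℝ i (fun y => ⟪W (y + h), stdOrthonormalBasis ℝ E j⟫ -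
        ⟪W y, stdOrthonormalBasis ℝ E j⟫) z‖ ≤ A * ‖h‖ := by
  set f : E → ℝ := fun y => ⟪W y, stdOrthonormalBasis ℝ E j⟫ with hf
  have hfk : ContDiff ℝ k f := hW.inner ℝ contDiff_const
  have hi1 : ((i + 1 : ℕ) : WithTop ℕ∞) ≤ k := by exact_mod_cast hi
  have hfi : ContDiff ℝ (i + 1) f := by exact_mod_cast hfk.of_le hi1
  have hfun : (fun y => ⟪W (y + h), stdOrthonormalBasis ℝ E j⟫ - ⟪W y, stdOrthonormalBasis ℝ E j⟫) =
      (fun y => f (y + h)) - f := by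
    funext y; simp [hf]
  have hsh : ContDiff ℝ k fun y => f (y + h) := hfk.comp (contDiff_id.add contDiff_const)
  have hik : ((i : ℕ) : WithTop ℕ∞) ≤ k := by exact_mod_cast hi.le
  rw [hfun, iteratedFDeriv_sub_apply (hsh.contDiffAt.of_le hik) (hfk.contDiffAt.of_le hik),
    iteratedFDeriv_comp_add_right]
  exact norm_iteratedFDeriv_add_sub_le hfi
    (fun y => norm_iteratedFDeriv_frameComponent_le hW le_rfl hbd j (Nat.succ_le_of_lt hi) y) z h

omit [MeasurableSpace E] [BorelSpace E] in
/-- Top order: `‖Dᵏ(⟪W(· + h), eⱼ⟫ − ⟪W, eⱼ⟫)(z)‖ ≤ ‖DᵏW(z + h) − DᵏW(z)‖`. [folklore] -/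
theorem norm_iteratedFDeriv_frameComponent_sub_le_top (hW : ContDiff ℝ k W)
    (j : Fin (Module.finrank ℝ E)) (h z : E) :
    ‖iteratedFDeriv ℝ k (fun y => ⟪W (y + h), stdOrthonormalBasis ℝ E j⟫ -
        ⟪W y, stdOrthonormalBasis ℝ E j⟫) z‖ ≤
      ‖iteratedFDeriv ℝ k W (z + h) - iteratedFDeriv ℝ k W z‖ := by
  have hsh : ContDiff ℝ k fun y => W (y + h) := hW.comp (contDiff_id.add contDiff_const)
  have h1 := norm_iteratedFDeriv_inner_sub_inner_le hsh hW (norm_stdOrthonormalBasis_le_one (E := E) j) le_rfl z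
  rwa [iteratedFDeriv_comp_add_right] at h1

omit [MeasurableSpace E] [BorelSpace E] in
/-- **First-difference bound for the level tensor of one slice** ("taking difference quotients",
KNSS (3.12)): if `W ∈ Cᵏ` with `‖DⁱW‖ ≤ A` (`i ≤ k`) and `‖DᵏW(· + h) − DᵏW‖ ≤ q` pointwise, then
`‖Dᵏ(WⱼWₗ)(y + h) − Dᵏ(WⱼWₗ)(y)‖ ≤ 2Aq + 2ᵏ⁺¹A²‖h‖` — the discrete Leibniz rule
`(fg)(· + h) − fg = (f(· + h) − f)g(· + h) + (g(· + h) − g)f`, the orders `< k` of each difference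
being `O(‖h‖)` by the mean value theorem and the top order being the unknown `q`. [folklore] -/
theorem norm_iteratedFDeriv_frameProduct_add_sub_le (hW : ContDiff ℝ k W) (hA : 0 ≤ A) {q : ℝ}
    (hq : 0 ≤ q) (hbd : ∀ i ≤ k, ∀ y, ‖iteratedFDeriv ℝ i W y‖ ≤ A) (h : E)
    (hdiff : ∀ y, ‖iteratedFDeriv ℝ k W (y + h) - iteratedFDeriv ℝ k W y‖ ≤ q)
    (j l : Fin (Module.finrank ℝ E)) (y : E) :
    ‖iteratedFDeriv ℝ k
          (fun y => ⟪W y, stdOrthonormalBasis ℝ E j⟫ * ⟪W y, stdOrthonormalBasis ℝ E l⟫) (y + h) -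
        iteratedFDeriv ℝ k
          (fun y => ⟪W y, stdOrthonormalBasis ℝ E j⟫ * ⟪W y, stdOrthonormalBasis ℝ E l⟫) y‖ ≤
      2 * A * q + 2 ^ (k + 1) * A ^ 2 * ‖h‖ := by
  set e := stdOrthonormalBasis ℝ E with he
  set f : E → ℝ := fun y => ⟪W y, e j⟫ with hf
  set g : E → ℝ := fun y => ⟪W y, e l⟫ with hg
  have hfk : ContDiff ℝ k f := hW.inner ℝ contDiff_const
  have hgk : ContDiff ℝ k g := hW.inner ℝ contDiff_const
  have hfs : ContDiff ℝ k fun y => f (y + h) := hfk.comp (contDiff_id.add contDiff_const)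
  have hgs : ContDiff ℝ k fun y => g (y + h) := hgk.comp (contDiff_id.add contDiff_const)
  -- the two pieces of the discrete Leibniz rule
  set D₁ : E → ℝ := fun y => (f (y + h) - f y) * g (y + h) with hD₁
  set D₂ : E → ℝ := fun y => (g (y + h) - g y) * f y with hD₂
  have hD₁k : ContDiff ℝ k D₁ := (hfs.sub hfk).mul hgs
  have hD₂k : ContDiff ℝ k D₂ := (hgs.sub hgk).mul hfk
  have hPk : ContDiff ℝ k fun y => f y * g y := hfk.mul hgk
  have hleib : (fun y => f (y + h) * g (y + h)) = (D₁ + D₂) + fun y => f y * g y := by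
    funext y; simp only [hD₁, hD₂, Pi.add_apply]; ring
  have hshift : iteratedFDeriv ℝ k (fun y => f y * g y) (y + h) =
      iteratedFDeriv ℝ k (fun y => f (y + h) * g (y + h)) y := by
    rw [← iteratedFDeriv_comp_add_right]
  have hD12 : ContDiff ℝ k (D₁ + D₂) := hD₁k.add hD₂k
  rw [hshift, hleib, iteratedFDeriv_add_apply hD12.contDiffAt hPk.contDiffAt,
    iteratedFDeriv_add_apply hD₁k.contDiffAt hD₂k.contDiffAt]
  rw [show (fun y => f y * g y) = (fun y => ⟪W y, stdOrthonormalBasis ℝ E j⟫ *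
      ⟪W y, stdOrthonormalBasis ℝ E l⟫) from rfl, add_sub_cancel_right]
  -- bounds for the factors
  have hfa : ∀ i < k, ∀ z, ‖iteratedFDeriv ℝ i (fun y => f (y + h) - f y) z‖ ≤ A * ‖h‖ :=
    fun i hi z => norm_iteratedFDeriv_frameComponent_sub_le_of_lt hW hbd j h hi z
  have hga : ∀ i < k, ∀ z, ‖iteratedFDeriv ℝ i (fun y => g (y + h) - g y) z‖ ≤ A * ‖h‖ :=
    fun i hi z => norm_iteratedFDeriv_frameComponent_sub_le_of_lt hW hbd l h hi z
  have hfq : ∀ z, ‖iteratedFDeriv ℝ k (fun y => f (y + h) - f y) z‖ ≤ q := fun z =>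
    (norm_iteratedFDeriv_frameComponent_sub_le_top hW j h z).trans (hdiff z)
  have hgq : ∀ z, ‖iteratedFDeriv ℝ k (fun y => g (y + h) - g y) z‖ ≤ q := fun z =>
    (norm_iteratedFDeriv_frameComponent_sub_le_top hW l h z).trans (hdiff z)
  have hgsb : ∀ i ≤ k, ∀ z, ‖iteratedFDeriv ℝ i (fun y => g (y + h)) z‖ ≤ A := fun i hi z => by
    rw [iteratedFDeriv_comp_add_right]
    exact norm_iteratedFDeriv_frameComponent_le hW le_rfl hbd l hi _
  have hfb : ∀ i ≤ k, ∀ z, ‖iteratedFDeriv ℝ i f z‖ ≤ A := fun i hi z =>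
    norm_iteratedFDeriv_frameComponent_le hW le_rfl hbd j hi z
  have hAh : 0 ≤ A * ‖h‖ := mul_nonneg hA (norm_nonneg _)
  have h1 : ‖iteratedFDeriv ℝ k D₁ y‖ ≤ q * A + 2 ^ k * (A * ‖h‖) * A :=
    norm_iteratedFDeriv_mul_le_of_bounds_top (hfs.sub hfk) hgs le_rfl hAh hA hq hfa hfq hgsb y
  have h2 : ‖iteratedFDeriv ℝ k D₂ y‖ ≤ q * A + 2 ^ k * (A * ‖h‖) * A :=
    norm_iteratedFDeriv_mul_le_of_bounds_top (hgs.sub hgk) hfk le_rfl hAh hA hq hga hgq hfb y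
  calc ‖iteratedFDeriv ℝ k D₁ y + iteratedFDeriv ℝ k D₂ y‖
      ≤ (q * A + 2 ^ k * (A * ‖h‖) * A) + (q * A + 2 ^ k * (A * ‖h‖) * A) :=
        (norm_add_le _ _).trans (add_le_add h1 h2)
    _ = 2 * A * q + 2 ^ (k + 1) * A ^ 2 * ‖h‖ := by rw [pow_succ]; ring

end SliceTensor

/-! ### The Oseen operator on differences of level tensors (dimension three) -/

section OseenDifference

variable {E : Type*} [NormedAddCommGroup E] [InnerProductSpace ℝ E] [FiniteDimensional ℝ E]
  [MeasurableSpace E] [BorelSpace E]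

variable (hE : Module.finrank ℝ E = 3)
include hE

variable {W : E → E} {k : ℕ} {A : ℝ}

omit [FiniteDimensional ℝ E] [MeasurableSpace E] [BorelSpace E] in
/-- `3 = dim E` copies of a constant sum to `3 ×` the constant. [folklore] -/
theorem sum_const_fin_finrank (c : ℝ) : ∑ _i : Fin (Module.finrank ℝ E), c = 3 * c := by
  rw [Finset.sum_const, Finset.card_univ, Fintype.card_fin, hE, nsmul_eq_mul]
  push_cast
  ring

/-- **Size of the level-`k` Oseen integrand of one slice**:
`‖∑ᵢ 𝒩_τ[Tₖᵐ]ᵢ(x) eᵢ‖ ≤ 8829 τ^{-1/2} 2ᵏA² ∏‖mᵢ‖` (`3 · 2943`). [folklore] -/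
theorem norm_sum_oseenHeat_levelTensor_smul_le (hW : ContDiff ℝ k W) (hA : 0 ≤ A)
    (hbd : ∀ i ≤ k, ∀ y, ‖iteratedFDeriv ℝ i W y‖ ≤ A) (m : Fin k → E) {τ : ℝ} (hτ : 0 < τ)
    (x : E) :
    ‖∑ i, oseenHeat τ (fun j l y => iteratedFDeriv ℝ k
        (fun y => ⟪W y, stdOrthonormalBasis ℝ E j⟫ * ⟪W y, stdOrthonormalBasis ℝ E l⟫) y m) i x •
        stdOrthonormalBasis ℝ E i‖ ≤
      8829 * τ ^ (-(1 / 2 : ℝ)) * (2 ^ k * A ^ 2 * ∏ i, ‖m i‖) := by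
  have hF := fun j l => (memLp_top_levelTensor hW hA hbd j l m).1
  have hB := fun j l => (memLp_top_levelTensor hW hA hbd j l m).2
  have hB0 : 0 ≤ 2 ^ k * A ^ 2 * ∏ i, ‖m i‖ := by positivity
  refine (norm_sum_smul_stdOrthonormalBasis_le _).trans ?_
  calc ∑ i, |oseenHeat τ (fun j l y => iteratedFDeriv ℝ k
          (fun y => ⟪W y, stdOrthonormalBasis ℝ E j⟫ * ⟪W y, stdOrthonormalBasis ℝ E l⟫) y m) i x|
      ≤ ∑ _i : Fin (Module.finrank ℝ E), 2943 * τ ^ (-(1 / 2 : ℝ)) * (2 ^ k * A ^ 2 * ∏ i, ‖m i‖) :=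
        Finset.sum_le_sum fun i _ => by
          rw [← Real.norm_eq_abs]
          exact norm_oseenHeat_le_of_top hE hF hB0 hB hτ i x
    _ = 8829 * τ ^ (-(1 / 2 : ℝ)) * (2 ^ k * A ^ 2 * ∏ i, ‖m i‖) := by
        rw [sum_const_fin_finrank hE]; ring

omit [MeasurableSpace E] [BorelSpace E] hE in
/-- A shifted level tensor is the level tensor of the shifted slice:
`Dᵏ(WⱼWₗ)(y + h)·m = Dᵏ(W(· + h)ⱼW(· + h)ₗ)(y)·m`. [folklore] -/
theorem levelTensor_shift (W : E → E) (k : ℕ) (m : Fin k → E) (j l : Fin (Module.finrank ℝ E))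
    (h : E) :
    (fun y => iteratedFDeriv ℝ k
        (fun y => ⟪W y, stdOrthonormalBasis ℝ E j⟫ * ⟪W y, stdOrthonormalBasis ℝ E l⟫) (y + h) m) =
      fun y => iteratedFDeriv ℝ k (fun y => ⟪W (y + h), stdOrthonormalBasis ℝ E j⟫ *
        ⟪W (y + h), stdOrthonormalBasis ℝ E l⟫) y m := by
  funext y
  rw [← iteratedFDeriv_comp_add_right]

omit hE in
/-- The shifted evaluated level tensor is in `L^∞` (same bound). [folklore] -/
theorem memLp_top_levelTensor_shift (hW : ContDiff ℝ k W) (hA : 0 ≤ A)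
    (hbd : ∀ i ≤ k, ∀ y, ‖iteratedFDeriv ℝ i W y‖ ≤ A) (j l : Fin (Module.finrank ℝ E))
    (m : Fin k → E) (h : E) :
    MemLp (fun y => iteratedFDeriv ℝ k
      (fun y => ⟪W y, stdOrthonormalBasis ℝ E j⟫ * ⟪W y, stdOrthonormalBasis ℝ E l⟫) (y + h) m)
      ∞ volume := by
  have hWs : ContDiff ℝ k fun y => W (y + h) := hW.comp (contDiff_id.add contDiff_const)
  have hbds : ∀ i ≤ k, ∀ y, ‖iteratedFDeriv ℝ i (fun y => W (y + h)) y‖ ≤ A := fun i hi y => by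
    rw [iteratedFDeriv_comp_add_right]; exact hbd i hi _
  rw [levelTensor_shift W k m j l h]
  exact (memLp_top_levelTensor hWs hA hbds j l m).1

/-- **The Oseen operator on a first difference** (any bounded matrix field): translation
covariance and linearity give `𝒩_τ[F]ᵢ(x + h) − 𝒩_τ[F]ᵢ(x) = 𝒩_τ[F(· + h) − F]ᵢ(x)`. [folklore] -/
theorem oseenHeat_apply_add_sub {F : Fin (Module.finrank ℝ E) → Fin (Module.finrank ℝ E) → E → ℝ}
    (hF : ∀ j l, MemLp (F j l) ∞ volume) {h : E} (hFs : ∀ j l, MemLp (fun y => F j l (y + h)) ∞ volume)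
    {τ : ℝ} (hτ : 0 < τ) (i : Fin (Module.finrank ℝ E)) (x : E) :
    oseenHeat τ F i (x + h) - oseenHeat τ F i x =
      oseenHeat τ (fun j l y => F j l (y + h) - F j l y) i x := by
  rw [← oseenHeat_comp_add_right F h τ i x]
  exact (oseenHeat_sub_of_memLp hE le_top hFs hF hτ i x).symm

/-- **Size of the Oseen operator on a first difference**: if `|F(· + h) − F| ≤ B` componentwise
then `‖∑ᵢ (𝒩_τ[F]ᵢ(x + h) − 𝒩_τ[F]ᵢ(x)) eᵢ‖ ≤ 8829 τ^{-1/2} B`. [folklore] -/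
theorem norm_sum_oseenHeat_apply_add_sub_smul_le
    {F : Fin (Module.finrank ℝ E) → Fin (Module.finrank ℝ E) → E → ℝ}
    (hF : ∀ j l, MemLp (F j l) ∞ volume) {h : E} (hFs : ∀ j l, MemLp (fun y => F j l (y + h)) ∞ volume)
    {B : ℝ} (hB0 : 0 ≤ B) (hB : ∀ j l y, |F j l (y + h) - F j l y| ≤ B)
    {τ : ℝ} (hτ : 0 < τ) (x : E) :
    ‖∑ i, (oseenHeat τ F i (x + h) - oseenHeat τ F i x) • stdOrthonormalBasis ℝ E i‖ ≤
      8829 * τ ^ (-(1 / 2 : ℝ)) * B := by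
  have hD : ∀ j l, MemLp (fun y => F j l (y + h) - F j l y) ∞ volume := fun j l => (hFs j l).sub (hF j l)
  have hDb : ∀ j l, eLpNorm (fun y => F j l (y + h) - F j l y) ∞ volume ≤ ENNReal.ofReal B := by
    intro j l
    rw [eLpNorm_exponent_top]
    exact eLpNormEssSup_le_of_ae_bound (Eventually.of_forall fun y => by
      rw [Real.norm_eq_abs]; exact hB j l y)
  refine (norm_sum_smul_stdOrthonormalBasis_le _).trans ?_
  calc ∑ i, |oseenHeat τ F i (x + h) - oseenHeat τ F i x|
      ≤ ∑ _i : Fin (Module.finrank ℝ E), 2943 * τ ^ (-(1 / 2 : ℝ)) * B :=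
        Finset.sum_le_sum fun i _ => by
          rw [oseenHeat_apply_add_sub hE hF hFs hτ i x, ← Real.norm_eq_abs]
          exact norm_oseenHeat_le_of_top hE hD hB0 hDb hτ i x
    _ = 8829 * τ ^ (-(1 / 2 : ℝ)) * B := by rw [sum_const_fin_finrank hE]; ring

/-- **The Oseen operator on the first difference of the level tensor of one slice**
(dimension three): if `W ∈ Cᵏ`, `‖DⁱW‖ ≤ A` (`i ≤ k`) and `‖DᵏW(· + h) − DᵏW‖ ≤ q`, then
`‖∑ᵢ (𝒩_τ[Tₖᵐ]ᵢ(x + h) − 𝒩_τ[Tₖᵐ]ᵢ(x)) eᵢ‖ ≤ 8829 τ^{-1/2} (2Aq + 2ᵏ⁺¹A²‖h‖) ∏‖mᵢ‖` — the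
bilinear estimate (4.5) of KNSS "taken in difference quotients" ((3.12)). [folklore] -/
theorem norm_sum_oseenHeat_levelTensor_add_sub_smul_le (hW : ContDiff ℝ k W) (hA : 0 ≤ A)
    (hbd : ∀ i ≤ k, ∀ y, ‖iteratedFDeriv ℝ i W y‖ ≤ A) {q : ℝ} (hq : 0 ≤ q) (h : E)
    (hdiff : ∀ y, ‖iteratedFDeriv ℝ k W (y + h) - iteratedFDeriv ℝ k W y‖ ≤ q) (m : Fin k → E)
    {τ : ℝ} (hτ : 0 < τ) (x : E) :
    ‖∑ i, (oseenHeat τ (fun j l y => iteratedFDeriv ℝ k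
          (fun y => ⟪W y, stdOrthonormalBasis ℝ E j⟫ * ⟪W y, stdOrthonormalBasis ℝ E l⟫) y m) i (x + h) -
        oseenHeat τ (fun j l y => iteratedFDeriv ℝ k
          (fun y => ⟪W y, stdOrthonormalBasis ℝ E j⟫ * ⟪W y, stdOrthonormalBasis ℝ E l⟫) y m) i x) •
        stdOrthonormalBasis ℝ E i‖ ≤
      8829 * τ ^ (-(1 / 2 : ℝ)) * ((2 * A * q + 2 ^ (k + 1) * A ^ 2 * ‖h‖) * ∏ i, ‖m i‖) := by
  have hF := fun j l => (memLp_top_levelTensor hW hA hbd j l m).1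
  have hFs := fun j l => memLp_top_levelTensor_shift hW hA hbd j l m h
  have hB0 : 0 ≤ (2 * A * q + 2 ^ (k + 1) * A ^ 2 * ‖h‖) * ∏ i, ‖m i‖ := by positivity
  refine norm_sum_oseenHeat_apply_add_sub_smul_le hE hF hFs hB0 (fun j l y => ?_) hτ x
  rw [← Real.norm_eq_abs, ← sub_apply]
  refine (ContinuousMultilinearMap.le_opNorm _ _).trans ?_
  exact mul_le_mul_of_nonneg_right (norm_iteratedFDeriv_frameProduct_add_sub_le hW hA hq hbd h hdiff j l y)
    (Finset.prod_nonneg fun i _ => norm_nonneg _)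

end OseenDifference

/-! ### The level-`k` Duhamel integrand of a field on the window: size and integrability -/

section Integrand

variable {E : Type*} [NormedAddCommGroup E] [InnerProductSpace ℝ E] [FiniteDimensional ℝ E]
  [MeasurableSpace E] [BorelSpace E]

omit [MeasurableSpace E] [BorelSpace E] in
/-- The zero-drift tensor as the frame product of the slice:
`driftTensor V 0 σ j l = (y ↦ ⟪V σ y, eⱼ⟫⟪V σ y, eₗ⟫)`. [folklore] -/
theorem driftTensor_zero_eq (V : ℝ → E → E) (σ : ℝ) (j l : Fin (Module.finrank ℝ E)) :
    driftTensor V 0 σ j l =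
      fun y => ⟪V σ y, stdOrthonormalBasis ℝ E j⟫ * ⟪V σ y, stdOrthonormalBasis ℝ E l⟫ := by
  funext y
  simp [driftTensor]

variable (hE : Module.finrank ℝ E = 3)
include hE

variable {V : ℝ → E → E} {T δ₀ A : ℝ} {k : ℕ}

/-- **Size of the level-`k` Duhamel integrand of a field with level-`k` bounds**: for
`ρ ∈ (s₁, σ')` inside the bounded range `[δ₀, T)`,
`‖∑ᵢ 𝒩_{σ'−ρ}[Tₖᵐ(ρ)]ᵢ(x) eᵢ‖ ≤ 8829 (σ' − ρ)^{-1/2} 2ᵏA² ∏‖mᵢ‖`. [folklore] -/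
theorem norm_levelIntegrand_le (hA : 0 ≤ A) (hsm : ∀ τ ∈ Ioo 0 T, ContDiff ℝ k (V τ))
    (hbd : ∀ j ≤ k, ∀ τ ∈ Ico δ₀ T, ∀ x, ‖iteratedFDeriv ℝ j (V τ) x‖ ≤ A) (m : Fin k → E)
    {s₁ σ' : ℝ} (hδs : δ₀ ≤ s₁) (h0s : 0 < s₁) (hσT : σ' ≤ T) {ρ : ℝ} (hρ : ρ ∈ Ioo s₁ σ')
    (x : E) :
    ‖∑ i, oseenHeat (σ' - ρ) (fun j l y => iteratedFDeriv ℝ k (driftTensor V 0 ρ j l) y m) i x •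
        stdOrthonormalBasis ℝ E i‖ ≤
      8829 * (σ' - ρ) ^ (-(1 / 2 : ℝ)) * (2 ^ k * A ^ 2 * ∏ i, ‖m i‖) := by
  have hρT : ρ ∈ Ioo 0 T := ⟨h0s.trans hρ.1, hρ.2.trans_le hσT⟩
  have hρδ : ρ ∈ Ico δ₀ T := ⟨hδs.trans hρ.1.le, hρT.2⟩
  simp only [driftTensor_zero_eq]
  exact norm_sum_oseenHeat_levelTensor_smul_le hE (hsm ρ hρT) hA (fun j hj y => hbd j hj ρ hρδ y) m
    (sub_pos.2 hρ.2) x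

/-- **Interval integrability of the level-`k` Duhamel integrand** on `[s₁, σ']` from the level
measurability datum (iv) at the clock `σ'` and the level bounds (majorant
`8829 (σ' − ρ)^{-1/2} 2ᵏA² ∏‖mᵢ‖`). [folklore] -/
theorem intervalIntegrable_levelIntegrand (hA : 0 ≤ A) (hsm : ∀ τ ∈ Ioo 0 T, ContDiff ℝ k (V τ))
    (hbd : ∀ j ≤ k, ∀ τ ∈ Ico δ₀ T, ∀ x, ‖iteratedFDeriv ℝ j (V τ) x‖ ≤ A) (m : Fin k → E)
    {s₁ σ' : ℝ} (hδs : δ₀ ≤ s₁) (h0s : 0 < s₁) (hsσ : s₁ ≤ σ') (hσT : σ' ≤ T)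
    (hms : ∀ (i : Fin (Module.finrank ℝ E)) (x : E), AEStronglyMeasurable
      (fun ρ => oseenHeat (σ' - ρ) (fun j l y => iteratedFDeriv ℝ k (driftTensor V 0 ρ j l) y m) i x)
      (volume.restrict (Ioo 0 σ')))
    (x : E) :
    IntervalIntegrable (fun ρ => ∑ i, oseenHeat (σ' - ρ)
        (fun j l y => iteratedFDeriv ℝ k (driftTensor V 0 ρ j l) y m) i x • stdOrthonormalBasis ℝ E i)
      volume s₁ σ' := by
  rw [intervalIntegrable_iff_integrableOn_Ioo_of_le hsσ]
  have hsub : Ioo s₁ σ' ⊆ Ioo 0 σ' := Ioo_subset_Ioo_left h0s.le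
  have hmeas : AEStronglyMeasurable (fun ρ => ∑ i, oseenHeat (σ' - ρ)
      (fun j l y => iteratedFDeriv ℝ k (driftTensor V 0 ρ j l) y m) i x • stdOrthonormalBasis ℝ E i)
      (volume.restrict (Ioo s₁ σ')) :=
    Finset.aestronglyMeasurable_fun_sum _ fun i _ =>
      ((hms i x).mono_measure (Measure.restrict_mono hsub le_rfl)).smul_const _
  have hw : IntegrableOn (fun ρ : ℝ => 8829 * (σ' - ρ) ^ (-(1 / 2 : ℝ)) *
      (2 ^ k * A ^ 2 * ∏ i, ‖m i‖)) (Ioo s₁ σ') := by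
    have := ((intervalIntegrable_rpow_neg_half_sub_right s₁ σ' σ').const_mul 8829).mul_const
      (2 ^ k * A ^ 2 * ∏ i, ‖m i‖)
    exact (intervalIntegrable_iff_integrableOn_Ioo_of_le hsσ).1 this
  refine Integrable.mono' hw hmeas ((ae_restrict_iff' measurableSet_Ioo).2
    (Eventually.of_forall fun ρ hρ => ?_))
  exact norm_levelIntegrand_le hE hA hsm hbd m hδs h0s hσT hρ x

/-- Norm of the level-`k` Duhamel integral: `‖∫_{s₁}^{σ'} …‖ ≤ 17658 · 2ᵏA² (σ' − s₁)^{1/2} ∏‖mᵢ‖`.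
[folklore] -/
theorem norm_integral_levelIntegrand_le (hA : 0 ≤ A) (hsm : ∀ τ ∈ Ioo 0 T, ContDiff ℝ k (V τ))
    (hbd : ∀ j ≤ k, ∀ τ ∈ Ico δ₀ T, ∀ x, ‖iteratedFDeriv ℝ j (V τ) x‖ ≤ A) (m : Fin k → E)
    {s₁ σ' : ℝ} (hδs : δ₀ ≤ s₁) (h0s : 0 < s₁) (hsσ : s₁ ≤ σ') (hσT : σ' ≤ T) (x : E) :
    ‖∫ ρ in s₁..σ', ∑ i, oseenHeat (σ' - ρ)
        (fun j l y => iteratedFDeriv ℝ k (driftTensor V 0 ρ j l) y m) i x • stdOrthonormalBasis ℝ E i‖ ≤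
      17658 * (2 ^ k * A ^ 2 * ∏ i, ‖m i‖) * (σ' - s₁) ^ (1 / 2 : ℝ) := by
  have h := intervalIntegral.norm_integral_le_of_norm_le (μ := volume) (a := s₁) (b := σ')
    (f := fun ρ => ∑ i, oseenHeat (σ' - ρ)
        (fun j l y => iteratedFDeriv ℝ k (driftTensor V 0 ρ j l) y m) i x • stdOrthonormalBasis ℝ E i)
    (g := fun ρ : ℝ => 8829 * (σ' - ρ) ^ (-(1 / 2 : ℝ)) * (2 ^ k * A ^ 2 * ∏ i, ‖m i‖)) hsσ
    (ae_mem_Ioc_of_forall_Ioo fun ρ hρ => norm_levelIntegrand_le hE hA hsm hbd m hδs h0s hσT hρ x)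
    (((intervalIntegrable_rpow_neg_half_sub_right s₁ σ' σ').const_mul 8829).mul_const _)
  refine h.trans (le_of_eq ?_)
  rw [intervalIntegral.integral_mul_const, intervalIntegral.integral_const_mul,
    integral_rpow_neg_half_sub_right σ' s₁ σ', sub_self,
    Real.zero_rpow (by norm_num : (1 / 2 : ℝ) ≠ 0), sub_zero]
  ring

end Integrand

/-! ### Level zero: the drift-mild field itself -/

section LevelZero

variable {E : Type*} [NormedAddCommGroup E] [InnerProductSpace ℝ E] [FiniteDimensional ℝ E]
  [MeasurableSpace E] [BorelSpace E]

variable (hE : Module.finrank ℝ E = 3)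
include hE

variable {T N : ℝ} {V : ℝ → E → E}

/-- Level `0`, (i): every slice of a drift-mild field in the open window is continuous (`C⁰`).
[folklore] -/
theorem levelZero_contDiff (hV : IsKNSSDriftMild T N V 0) {τ : ℝ} (hτ : τ ∈ Ioo 0 T) :
    ContDiff ℝ 0 (V τ) :=
  contDiff_zero.2 (hV.continuous_slice hE hτ)

omit hE in
/-- Level `0`, (ii): `‖D⁰V(τ)(x)‖ = ‖V τ x‖ ≤ N` on the window. [folklore] -/
theorem levelZero_bound (hV : IsKNSSDriftMild T N V 0) {δ : ℝ} (hδ : 0 < δ) :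
    ∀ j ≤ 0, ∀ τ ∈ Ico δ T, ∀ x, ‖iteratedFDeriv ℝ j (V τ) x‖ ≤ N := by
  intro j hj τ hτ x
  rw [Nat.le_zero.1 hj, norm_iteratedFDeriv_zero]
  exact hV.norm_le τ ⟨hδ.trans_le hτ.1, hτ.2⟩ x

omit hE in
/-- Level `0`, (iii): the evaluated order-`0` identity **is** the drift-mild identity
`V(τ) = e^{(τ−s₁)Δ}V(s₁) − driftDuhamel V 0 s₁ τ` (`D⁰f(x)·m = f x`, `T₀ᵐ = V ⊗ V`). [folklore] -/
theorem levelZero_identity (hV : IsKNSSDriftMild T N V 0) (m : Fin 0 → E) {s₁ τ : ℝ}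
    (hs₁ : 0 < s₁) (hs₁τ : s₁ < τ) (hτ : τ < T) (x : E) :
    iteratedFDeriv ℝ 0 (V τ) x m =
      UnboundedOperators.heatExtension (fun y => iteratedFDeriv ℝ 0 (V s₁) y m) (τ - s₁) x -
      ∫ σ in s₁..τ, ∑ i, oseenHeat (τ - σ)
        (fun j l y => iteratedFDeriv ℝ 0 (driftTensor V 0 σ j l) y m) i x • stdOrthonormalBasis ℝ E i := by
  simp only [iteratedFDeriv_zero_apply]
  exact hV.mild s₁ τ hs₁ hs₁τ hτ x

/-- Level `0`, (iv): measurability of `σ ↦ 𝒩_{τ−σ}[V(σ) ⊗ V(σ)]ᵢ(x)` on `(0, τ)` for `τ ≤ T`, at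
every point `x` (the tree's `aestronglyMeasurable_oseenHeat_sub_section` for the bounded, jointly
measurable zero-drift tensor). [folklore] -/
theorem levelZero_measurable (hV : IsKNSSDriftMild T N V 0) (m : Fin 0 → E) {τ : ℝ} (hτ : τ ≤ T)
    (i : Fin (Module.finrank ℝ E)) (x : E) :
    AEStronglyMeasurable (fun σ => oseenHeat (τ - σ)
      (fun j l y => iteratedFDeriv ℝ 0 (driftTensor V 0 σ j l) y m) i x) (volume.restrict (Ioo 0 τ)) := by
  have hfun : (fun σ => oseenHeat (τ - σ)
      (fun j l y => iteratedFDeriv ℝ 0 (driftTensor V 0 σ j l) y m) i x) =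
      fun σ => oseenHeat (τ - σ) (driftTensor V 0 σ) i x := by
    funext σ
    simp only [iteratedFDeriv_zero_apply]
  rw [hfun]
  exact aestronglyMeasurable_oseenHeat_sub_section hE (F := fun σ => driftTensor V 0 σ)
    hV.measurable_driftTensor measurableSet_Ioo (fun σ hσ => hσ.2) (B := 4 * N ^ 2)
    (fun σ hσ j l y => hV.abs_driftTensor_le ⟨hσ.1, hσ.2.trans_le hτ⟩ j l y) i x

end LevelZero

/-! ### The Lipschitz step: a sup-form singular Gronwall argument on first differences -/

section Lipschitz

variable {E : Type*} [NormedAddCommGroup E] [InnerProductSpace ℝ E] [FiniteDimensional ℝ E]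
  [MeasurableSpace E] [BorelSpace E]

variable (hE : Module.finrank ℝ E = 3)
include hE

omit [MeasurableSpace E] [BorelSpace E] hE in
/-- `((1/c)²)^{1/2} = 1/c` for `c > 0`. [folklore] -/
theorem sq_rpow_half_eq {c : ℝ} (hc : 0 < c) : ((1 / c) ^ 2) ^ (1 / 2 : ℝ) = 1 / c := by
  have h0 : 0 ≤ 1 / c := by positivity
  rw [show ((1 / c) ^ 2 : ℝ) = (1 / c) ^ (2 : ℝ) by norm_cast, ← Real.rpow_mul h0]
  norm_num

/-- **The Lipschitz step of the bootstrap** (KNSS 2009, Prop. 4.1 / (4.6), order `k + 1`, in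
difference-quotient form). Fix the window length `T`, an order `k`, a level bound `A ≥ 1` and
`δ > 0`. There is `L = L(k, A, δ)` such that for every field `V` carrying the level-`k` data on
`(0, T)` — `Cᵏ` slices, `‖DʲV(τ)‖ ≤ A` for `j ≤ k` and `τ ∈ [δ/2, T)`, the `k`-times
differentiated mild identity (iii)ₖ and the measurability (iv)ₖ — one has
`‖DᵏV(τ)(x + h) − DᵏV(τ)(x)‖ ≤ L‖h‖` for all `τ ∈ [δ, T)`, `x`, `h`. Proof: on the window
`[τ − η, τ]`, `η = min(δ/2, (141264 A)⁻²)`, let `K` be the sup of the weighted increments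
`(σ − s₁)^{1/2}‖DᵏV(σ)(y + h) − DᵏV(σ)(y)‖` (finite a priori: `≤ 2A`). Subtracting (iii)ₖ at `y + h`
and `y`, the caloric term contributes `3(σ − s₁)^{-1/2}A‖h‖` (gradient bound of `e^{rΔ}` on
bounded data) and the Duhamel term, by `norm_sum_oseenHeat_levelTensor_add_sub_smul_le` with the
unknown `q = (ρ − s₁)^{-1/2}K` and the Beta bound `∫(σ−ρ)^{-1/2}(ρ−s₁)^{-1/2} ≤ 4`, contributes
`70632·A·K + 8829·2ᵏ⁺²A²(σ − s₁)^{1/2}‖h‖`; hence every weighted increment is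
`≤ Λ‖h‖ + 70632 A η^{1/2} K ≤ Λ‖h‖ + K/2`, so `K ≤ 2Λ‖h‖` and `L = 2Λη^{-1/2}`,
`Λ = 3A + 8829·2ᵏ⁺²A²`. The constant depends on `k, A, δ` only (uniformity in the solution,
KNSS's `C(k, δ, T, M)`). [cite: KochNadirashviliSereginSverak2009, Prop. 4.1 with (4.5)–(4.6) and (3.12) (arXiv:0709.3599v1 pp. 6–8)] -/
theorem lipschitz_iteratedFDeriv_of_level {T : ℝ} (k : ℕ) {A δ : ℝ} (hA : 1 ≤ A) (hδ : 0 < δ) :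
    ∃ L : ℝ, 0 ≤ L ∧ ∀ ⦃V : ℝ → E → E⦄,
      (∀ τ ∈ Ioo 0 T, ContDiff ℝ k (V τ)) →
      (∀ j ≤ k, ∀ τ ∈ Ico (δ / 2) T, ∀ x, ‖iteratedFDeriv ℝ j (V τ) x‖ ≤ A) →
      (∀ (m : Fin k → E) (s₁ τ : ℝ), 0 < s₁ → s₁ < τ → τ < T → ∀ x,
        iteratedFDeriv ℝ k (V τ) x m =
          UnboundedOperators.heatExtension (fun y => iteratedFDeriv ℝ k (V s₁) y m) (τ - s₁) x -
          ∫ σ in s₁..τ, ∑ i, oseenHeat (τ - σ)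
            (fun j l y => iteratedFDeriv ℝ k (driftTensor V 0 σ j l) y m) i x •
              stdOrthonormalBasis ℝ E i) →
      (∀ (m : Fin k → E) (τ : ℝ), τ ≤ T → ∀ (i : Fin (Module.finrank ℝ E)) (x : E),
        AEStronglyMeasurable (fun σ => oseenHeat (τ - σ)
          (fun j l y => iteratedFDeriv ℝ k (driftTensor V 0 σ j l) y m) i x)
          (volume.restrict (Ioo 0 τ))) →
      ∀ τ ∈ Ico δ T, ∀ x h : E,
        ‖iteratedFDeriv ℝ k (V τ) (x + h) - iteratedFDeriv ℝ k (V τ) x‖ ≤ L * ‖h‖ := by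
  -- the constants
  have hA0 : 0 ≤ A := zero_le_one.trans hA
  set Λ : ℝ := 3 * A + 8829 * 2 ^ (k + 2) * A ^ 2 with hΛ
  have hΛ0 : 0 ≤ Λ := by positivity
  set η : ℝ := min (δ / 2) ((1 / (141264 * A)) ^ 2) with hη
  have hcA : 0 < 141264 * A := by positivity
  have hη0 : 0 < η := lt_min (half_pos hδ) (by positivity)
  have hηδ : η ≤ δ / 2 := min_le_left _ _
  have hηA : η ≤ (1 / (141264 * A)) ^ 2 := min_le_right _ _
  have hη1 : η ≤ 1 := by
    refine hηA.trans ?_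
    have h1 : 1 / (141264 * A) ≤ 1 := by
      rw [div_le_one hcA]; nlinarith
    have h0 : 0 ≤ 1 / (141264 * A) := by positivity
    nlinarith
  have hηhalf : η ^ (1 / 2 : ℝ) ≤ 1 / (141264 * A) := by
    calc η ^ (1 / 2 : ℝ) ≤ ((1 / (141264 * A)) ^ 2) ^ (1 / 2 : ℝ) :=
          Real.rpow_le_rpow hη0.le hηA (by norm_num)
      _ = 1 / (141264 * A) := sq_rpow_half_eq hcA
  refine ⟨2 * Λ * η ^ (-(1 / 2 : ℝ)), by positivity, ?_⟩
  intro V hsm hbd hid hms τ hτ x h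
  -- the window `[s₁, τ]`, `s₁ = τ - η`
  set s₁ : ℝ := τ - η with hs₁
  have hs₁δ : δ / 2 ≤ s₁ := by rw [hs₁]; linarith [hτ.1]
  have hs₁0 : 0 < s₁ := lt_of_lt_of_le (half_pos hδ) hs₁δ
  have hs₁τ : s₁ < τ := by rw [hs₁]; linarith
  have hτT : τ < T := hτ.2
  have hτs₁ : τ - s₁ = η := by rw [hs₁]; ring
  -- level bounds on the window
  have hbdw : ∀ σ ∈ Ioc s₁ τ, ∀ j ≤ k, ∀ y, ‖iteratedFDeriv ℝ j (V σ) y‖ ≤ A :=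
    fun σ hσ j hj y => hbd j hj σ ⟨hs₁δ.trans hσ.1.le, hσ.2.trans_lt hτT⟩ y
  have hsmw : ∀ σ ∈ Ioc s₁ τ, ContDiff ℝ k (V σ) :=
    fun σ hσ => hsm σ ⟨hs₁0.trans hσ.1, hσ.2.trans_lt hτT⟩
  -- the set of weighted increments and its sup
  set S : Set ℝ := {r | ∃ σ ∈ Ioc s₁ τ, ∃ y : E, r = (σ - s₁) ^ (1 / 2 : ℝ) *
    ‖iteratedFDeriv ℝ k (V σ) (y + h) - iteratedFDeriv ℝ k (V σ) y‖} with hS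
  have hwle : ∀ σ ∈ Ioc s₁ τ, (σ - s₁) ^ (1 / 2 : ℝ) ≤ η ^ (1 / 2 : ℝ) := fun σ hσ =>
    Real.rpow_le_rpow (sub_nonneg.2 hσ.1.le) (by linarith [hσ.2]) (by norm_num)
  have hη12 : η ^ (1 / 2 : ℝ) ≤ 1 := Real.rpow_le_one hη0.le hη1 (by norm_num)
  have hSbdd : BddAbove S := by
    refine ⟨2 * A, ?_⟩
    rintro r ⟨σ, hσ, y, rfl⟩
    have h1 : ‖iteratedFDeriv ℝ k (V σ) (y + h) - iteratedFDeriv ℝ k (V σ) y‖ ≤ A + A :=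
      (norm_sub_le _ _).trans (add_le_add (hbdw σ hσ k le_rfl _) (hbdw σ hσ k le_rfl _))
    have h2 : (σ - s₁) ^ (1 / 2 : ℝ) ≤ 1 := (hwle σ hσ).trans hη12
    have h3 : 0 ≤ (σ - s₁) ^ (1 / 2 : ℝ) := Real.rpow_nonneg (sub_nonneg.2 hσ.1.le) _
    nlinarith [norm_nonneg (iteratedFDeriv ℝ k (V σ) (y + h) - iteratedFDeriv ℝ k (V σ) y)]
  have hτmem : τ ∈ Ioc s₁ τ := ⟨hs₁τ, le_rfl⟩
  have hSne : S.Nonempty := ⟨_, τ, hτmem, x, rfl⟩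
  set K : ℝ := sSup S with hK
  have hmem : ∀ σ ∈ Ioc s₁ τ, ∀ y : E, (σ - s₁) ^ (1 / 2 : ℝ) *
      ‖iteratedFDeriv ℝ k (V σ) (y + h) - iteratedFDeriv ℝ k (V σ) y‖ ≤ K :=
    fun σ hσ y => le_csSup hSbdd ⟨σ, hσ, y, rfl⟩
  have hK0 : 0 ≤ K := le_trans (by positivity) (hmem τ hτmem x)
  -- the unknown at time `ρ`: `‖DᵏV(ρ)(· + h) − DᵏV(ρ)‖ ≤ (ρ − s₁)^{-1/2} K`
  have hq : ∀ ρ ∈ Ioc s₁ τ, ∀ y : E,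
      ‖iteratedFDeriv ℝ k (V ρ) (y + h) - iteratedFDeriv ℝ k (V ρ) y‖ ≤ (ρ - s₁) ^ (-(1 / 2 : ℝ)) * K := by
    intro ρ hρ y
    have hpos : 0 < ρ - s₁ := sub_pos.2 hρ.1
    have h1 := mul_le_mul_of_nonneg_left (hmem ρ hρ y) (Real.rpow_nonneg hpos.le (-(1 / 2 : ℝ)))
    rwa [← mul_assoc, rpow_neg_half_mul_rpow_half hpos, one_mul] at h1
  -- the key estimate: every weighted increment is at most `Λ‖h‖ + K/2`
  have hkey : ∀ r ∈ S, r ≤ Λ * ‖h‖ + sSup S / 2 := by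
    rintro r ⟨σ, hσ, y, rfl⟩
    have hσ0 : 0 < σ - s₁ := sub_pos.2 hσ.1
    have hs₁σ : s₁ < σ := hσ.1
    have hσT : σ < T := hσ.2.trans_lt hτT
    have hσT' : σ ≤ T := hσT.le
    set Δ := iteratedFDeriv ℝ k (V σ) (y + h) - iteratedFDeriv ℝ k (V σ) y with hΔ
    -- the pointwise bound `‖Δ‖ ≤ B`
    set B : ℝ := 3 * (σ - s₁) ^ (-(1 / 2 : ℝ)) * A * ‖h‖ + 70632 * A * K +
      8829 * 2 ^ (k + 2) * A ^ 2 * (σ - s₁) ^ (1 / 2 : ℝ) * ‖h‖ with hB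
    have hB0 : 0 ≤ B := by positivity
    have hΔB : ‖Δ‖ ≤ B := by
      refine ContinuousMultilinearMap.opNorm_le_bound hB0 fun m => ?_
      set P : ℝ := ∏ i, ‖m i‖ with hP
      have hP0 : 0 ≤ P := Finset.prod_nonneg fun i _ => norm_nonneg _
      -- the caloric datum `g = DᵏV(s₁)·m`
      set g : E → E := fun z => iteratedFDeriv ℝ k (V s₁) z m with hg
      have hs₁T : s₁ ∈ Ioo 0 T := ⟨hs₁0, hs₁τ.trans hτT⟩
      have hgc : Continuous g :=
        (ContinuousMultilinearMap.apply ℝ (fun _ : Fin k => E) E m).continuous.comp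
          ((hsm s₁ hs₁T).continuous_iteratedFDeriv le_rfl)
      have hgb : ∀ z, ‖g z‖ ≤ A * P := fun z =>
        (ContinuousMultilinearMap.le_opNorm _ _).trans
          (mul_le_mul_of_nonneg_right (hbd k le_rfl s₁ ⟨hs₁δ, hs₁T.2⟩ z) hP0)
      -- the caloric term
      set HE : E → E := UnboundedOperators.heatExtension g (σ - s₁) with hHE
      have hHEd : Differentiable ℝ HE :=
        (UnboundedOperators.contDiff_heatExtension_of_bound hgc hgb hσ0 (m := 1)).differentiable one_ne_zero
      have hHEb : ∀ z, ‖fderiv ℝ HE z‖ ≤ 3 * (σ - s₁) ^ (-(1 / 2 : ℝ)) * (A * P) := fun z => by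
        refine (UnboundedOperators.norm_fderiv_heatExtension_le_of_bounded hgc.aestronglyMeasurable
          hgb hσ0 z).trans ?_
        have h3 := two_rpow_finrank_half_le_three hE
        have hr : 0 ≤ (σ - s₁) ^ (-(1 / 2 : ℝ)) := Real.rpow_nonneg hσ0.le _
        have hAP : 0 ≤ A * P := mul_nonneg hA0 hP0
        gcongr
      have hT1 : ‖HE (y + h) - HE y‖ ≤ 3 * (σ - s₁) ^ (-(1 / 2 : ℝ)) * (A * P) * ‖h‖ := by
        have hmv := (convex_univ (𝕜 := ℝ) (E := E)).norm_image_sub_le_of_norm_fderiv_le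
          (fun z _ => hHEd z) (fun z _ => hHEb z) (mem_univ y) (mem_univ (y + h))
        simpa using hmv
      -- the Duhamel term
      set G : ℝ → E → E := fun ρ z => ∑ i, oseenHeat (σ - ρ)
        (fun j l y => iteratedFDeriv ℝ k (driftTensor V 0 ρ j l) y m) i z • stdOrthonormalBasis ℝ E i
        with hG
      have hint : ∀ z, IntervalIntegrable (fun ρ => G ρ z) volume s₁ σ := fun z =>
        intervalIntegrable_levelIntegrand hE hA0 hsm hbd m hs₁δ hs₁0 hs₁σ.le hσT' (hms m σ hσT') z
      -- the majorant of the differenced integrand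
      set c₁ : ℝ := 8829 * (2 * A * K) * P with hc₁
      set c₂ : ℝ := 8829 * (2 ^ (k + 1) * A ^ 2 * ‖h‖) * P with hc₂
      have hc₁0 : 0 ≤ c₁ := by positivity
      have hc₂0 : 0 ≤ c₂ := by positivity
      set bnd : ℝ → ℝ := fun ρ => c₁ * ((σ - ρ) ^ (-(1 / 2 : ℝ)) * (ρ - s₁) ^ (-(1 / 2 : ℝ))) +
        c₂ * (σ - ρ) ^ (-(1 / 2 : ℝ)) with hbnd
      have hbndi : IntervalIntegrable bnd volume s₁ σ :=
        ((intervalIntegrable_rpow_neg_half_mul hs₁σ).const_mul c₁).add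
          ((intervalIntegrable_rpow_neg_half_sub_right s₁ σ σ).const_mul c₂)
      have hGdiff : ∀ ρ ∈ Ioo s₁ σ, ‖G ρ (y + h) - G ρ y‖ ≤ bnd ρ := by
        intro ρ hρ
        have hρτ : ρ ∈ Ioc s₁ τ := ⟨hρ.1, hρ.2.le.trans hσ.2⟩
        have hρT : ρ ∈ Ioo 0 T := ⟨hs₁0.trans hρ.1, hρ.2.trans hσT⟩
        have hρs : 0 < ρ - s₁ := sub_pos.2 hρ.1
        have hqρ : 0 ≤ (ρ - s₁) ^ (-(1 / 2 : ℝ)) * K := mul_nonneg (Real.rpow_nonneg hρs.le _) hK0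
        have hsub : G ρ (y + h) - G ρ y = ∑ i, (oseenHeat (σ - ρ)
            (fun j l y => iteratedFDeriv ℝ k (driftTensor V 0 ρ j l) y m) i (y + h) -
            oseenHeat (σ - ρ) (fun j l y => iteratedFDeriv ℝ k (driftTensor V 0 ρ j l) y m) i y) •
            stdOrthonormalBasis ℝ E i := by
          simp only [hG, ← Finset.sum_sub_distrib, ← sub_smul]
        rw [hsub]
        simp only [driftTensor_zero_eq]
        refine (norm_sum_oseenHeat_levelTensor_add_sub_smul_le hE (hsm ρ hρT) hA0
          (fun j hj z => hbdw ρ hρτ j hj z) hqρ h (hq ρ hρτ) m (sub_pos.2 hρ.2) y).trans (le_of_eq ?_)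
        simp only [hbnd, hc₁, hc₂, hP]
        ring
      have hT2 : ‖(∫ ρ in s₁..σ, G ρ (y + h)) - ∫ ρ in s₁..σ, G ρ y‖ ≤
          70632 * A * K * P + 8829 * 2 ^ (k + 2) * A ^ 2 * (σ - s₁) ^ (1 / 2 : ℝ) * ‖h‖ * P := by
        rw [← intervalIntegral.integral_sub (hint (y + h)) (hint y)]
        refine (intervalIntegral.norm_integral_le_of_norm_le hs₁σ.le
          (ae_mem_Ioc_of_forall_Ioo hGdiff) hbndi).trans ?_
        have hI1 := integral_rpow_neg_half_mul_rpow_neg_half_le hs₁σ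
        have hI2 : ∫ ρ in s₁..σ, (σ - ρ) ^ (-(1 / 2 : ℝ)) = 2 * (σ - s₁) ^ (1 / 2 : ℝ) := by
          rw [integral_rpow_neg_half_sub_right σ s₁ σ, sub_self,
            Real.zero_rpow (by norm_num : (1 / 2 : ℝ) ≠ 0), sub_zero]
        rw [hbnd, intervalIntegral.integral_add ((intervalIntegrable_rpow_neg_half_mul hs₁σ).const_mul c₁)
          ((intervalIntegrable_rpow_neg_half_sub_right s₁ σ σ).const_mul c₂),
          intervalIntegral.integral_const_mul, intervalIntegral.integral_const_mul, hI2]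
        calc c₁ * (∫ ρ in s₁..σ, (σ - ρ) ^ (-(1 / 2 : ℝ)) * (ρ - s₁) ^ (-(1 / 2 : ℝ))) +
              c₂ * (2 * (σ - s₁) ^ (1 / 2 : ℝ))
            ≤ c₁ * 4 + c₂ * (2 * (σ - s₁) ^ (1 / 2 : ℝ)) :=
              add_le_add (mul_le_mul_of_nonneg_left hI1 hc₁0) le_rfl
          _ = 70632 * A * K * P + 8829 * 2 ^ (k + 2) * A ^ 2 * (σ - s₁) ^ (1 / 2 : ℝ) * ‖h‖ * P := by
              simp only [hc₁, hc₂]; ring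
      -- the identity (iii)ₖ at `y + h` and at `y`
      have hidh := hid m s₁ σ hs₁0 hs₁σ hσT (y + h)
      have hidy := hid m s₁ σ hs₁0 hs₁σ hσT y
      have hΔm : Δ m = (HE (y + h) - HE y) - ((∫ ρ in s₁..σ, G ρ (y + h)) - ∫ ρ in s₁..σ, G ρ y) := by
        rw [hΔ, sub_apply, hidh, hidy]
        simp only [hHE, hG]
        abel
      rw [hΔm]
      calc ‖(HE (y + h) - HE y) - ((∫ ρ in s₁..σ, G ρ (y + h)) - ∫ ρ in s₁..σ, G ρ y)‖
          ≤ 3 * (σ - s₁) ^ (-(1 / 2 : ℝ)) * (A * P) * ‖h‖ +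
            (70632 * A * K * P + 8829 * 2 ^ (k + 2) * A ^ 2 * (σ - s₁) ^ (1 / 2 : ℝ) * ‖h‖ * P) :=
            (norm_sub_le _ _).trans (add_le_add hT1 hT2)
        _ = B * P := by simp only [hB]; ring
    -- weighting: `(σ - s₁)^{1/2} ‖Δ‖ ≤ Λ ‖h‖ + K / 2`
    have hw0 : 0 ≤ (σ - s₁) ^ (1 / 2 : ℝ) := Real.rpow_nonneg hσ0.le _
    have hw1 : (σ - s₁) ^ (1 / 2 : ℝ) ≤ η ^ (1 / 2 : ℝ) := hwle σ hσ
    have hwσ : σ - s₁ ≤ η := by linarith [hσ.2]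
    have hprod1 : (σ - s₁) ^ (1 / 2 : ℝ) * (σ - s₁) ^ (-(1 / 2 : ℝ)) = 1 := by
      rw [mul_comm, rpow_neg_half_mul_rpow_half hσ0]
    have hprod2 : (σ - s₁) ^ (1 / 2 : ℝ) * (σ - s₁) ^ (1 / 2 : ℝ) = σ - s₁ := by
      rw [← Real.rpow_add hσ0]; norm_num
    have hKhalf : 70632 * A * η ^ (1 / 2 : ℝ) * K ≤ K / 2 := by
      have h1 : 70632 * A * η ^ (1 / 2 : ℝ) ≤ 1 / 2 := by
        calc 70632 * A * η ^ (1 / 2 : ℝ) ≤ 70632 * A * (1 / (141264 * A)) :=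
              mul_le_mul_of_nonneg_left hηhalf (by positivity)
          _ = 1 / 2 := by field_simp; ring
      nlinarith
    calc (σ - s₁) ^ (1 / 2 : ℝ) * ‖Δ‖ ≤ (σ - s₁) ^ (1 / 2 : ℝ) * B := mul_le_mul_of_nonneg_left hΔB hw0
      _ = 3 * A * ‖h‖ * ((σ - s₁) ^ (1 / 2 : ℝ) * (σ - s₁) ^ (-(1 / 2 : ℝ))) +
            70632 * A * (σ - s₁) ^ (1 / 2 : ℝ) * K +
            8829 * 2 ^ (k + 2) * A ^ 2 * ((σ - s₁) ^ (1 / 2 : ℝ) * (σ - s₁) ^ (1 / 2 : ℝ)) * ‖h‖ := by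
          simp only [hB]; ring
      _ = 3 * A * ‖h‖ + 70632 * A * (σ - s₁) ^ (1 / 2 : ℝ) * K +
            8829 * 2 ^ (k + 2) * A ^ 2 * (σ - s₁) * ‖h‖ := by rw [hprod1, hprod2, mul_one]
      _ ≤ 3 * A * ‖h‖ + 70632 * A * η ^ (1 / 2 : ℝ) * K + 8829 * 2 ^ (k + 2) * A ^ 2 * 1 * ‖h‖ := by
          gcongr
          exact hwσ.trans hη1
      _ ≤ 3 * A * ‖h‖ + K / 2 + 8829 * 2 ^ (k + 2) * A ^ 2 * 1 * ‖h‖ := by linarith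
      _ = Λ * ‖h‖ + sSup S / 2 := by simp only [hΛ, hK]; ring
  -- conclusion: `K ≤ 2Λ‖h‖`, read off at `σ = τ`
  have hKle : K ≤ 2 * (Λ * ‖h‖) := sSup_le_two_mul_of_forall_le_add_half hSne hkey
  have hfin := hmem τ hτmem x
  rw [hτs₁] at hfin
  have hηpos : 0 < η ^ (1 / 2 : ℝ) := Real.rpow_pos_of_pos hη0 _
  have h1 : ‖iteratedFDeriv ℝ k (V τ) (x + h) - iteratedFDeriv ℝ k (V τ) x‖ ≤ η ^ (-(1 / 2 : ℝ)) * K := by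
    have h2 := mul_le_mul_of_nonneg_left hfin (Real.rpow_nonneg hη0.le (-(1 / 2 : ℝ)))
    rwa [← mul_assoc, rpow_neg_half_mul_rpow_half hη0, one_mul] at h2
  calc ‖iteratedFDeriv ℝ k (V τ) (x + h) - iteratedFDeriv ℝ k (V τ) x‖ ≤ η ^ (-(1 / 2 : ℝ)) * K := h1
    _ ≤ η ^ (-(1 / 2 : ℝ)) * (2 * (Λ * ‖h‖)) :=
        mul_le_mul_of_nonneg_left hKle (Real.rpow_nonneg hη0.le _)
    _ = 2 * Λ * η ^ (-(1 / 2 : ℝ)) * ‖h‖ := by ring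

end Lipschitz



end KNSSBootstrap

end Literature.Analysis.FluidPDE

end
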